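import Summits.Ventures.PercRepro.SixFourResidueFourPlaneLineTW
import Summits.Ventures.PercRepro.SixFourResidueBigPlane

/-!
# PercRepro — C-025 at `(6,4)`: the plane-line branch (γ) at `t = 4`, part 4 — the numeric clauses and the
reduction of `PlaneLineFourBig` to them (p5, gen 10; lead (nn))

With Lemma TW in its sharp form (`J_four_ge_TW'`) the plane-line branch beyond Theorem 22 rests on ONE purely
numeric statement about the prices `T⁺(g, q)`:

* **`TWSum`** — for every `g ≥ 11`, `n ≥ 3`, `e ∈ {0, 1}`, `p = g − n ≥ 4` and every multiset `sizes` of class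
  sizes (`1 + e ≤ s ≤ p − 3`, `Σ (s − e) = p − e`):
  `0 ≤ T⁺(g, p) − (24/5)·n + Σ_s w♯(g, n, s) − (12/5)·2^{n+e}·[two classes with s₁ + s₂ = p + e]`;
* **`planeLineFourBig_of_TWSum : TWSum → PlaneLineFourBig`** — every non-generic `G` with plane traces
  `≤ g − 3` and a trace `≥ 8` has `g ≥ 11` and a normalisation `D` (`exists_PLData`) whose class sizes satisfy
  the side conditions (`card_class_le`, `sum_card_classes'`, `coverPairs_card_classes`), so `J_four_ge_TW'`
  and the clause give `0 ≤ J₄`.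

The pieces of `TWSum`: **`TWTable`** (`13 ≤ g ≤ 100`) and **`TWTail`** (`g ≥ 101`) are mine-2's TW-100 / TW-∞ in
termwise form (`w′ ≥ 0` per class, `T⁺(g,p) ≥ 0`, the pair charge absorbed by the larger class), which imply the
sum form since `w♯ ≥ w′` (`twSum_of_termwise`); **`TWSumSmall`** (`g ∈ {11, 12}`) is the sum form itself — with
Lemma X̄′'s constant it holds on all 157 admissible size multisets (exact check, p5's `tmp/tw_small.py`), while
mine-2's termwise constant fails there (their coarse lists are not needed).  `SixFourResidueFourPlaneLineHolds`
discharges the three pieces.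
-/

namespace PercRepro.SixFour

open Finset ThmH

/-! ## The clauses -/

/-- The pair charge: `(12/5)·2^{n+e}` when exactly two classes have sizes summing to `p + e`. -/
noncomputable def pairCharge (n e p : ℕ) (sizes : Multiset ℕ) : ℚ :=
  if Multiset.card sizes = 2 ∧ sizes.sum = p + e then 12 / 5 * (2 : ℚ) ^ (n + e) else 0

/-- **`TWSum`**: the sharp termwise numerics of Lemma TW in sum form, for every `g ≥ 11`. -/
def TWSum : Prop :=
  ∀ g n e : ℕ, 11 ≤ g → 3 ≤ n → e ≤ 1 → n + 4 ≤ g → ∀ sizes : Multiset ℕ,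
    (∀ s ∈ sizes, e + 1 ≤ s ∧ s + 3 ≤ g - n) →
    sizes.sum = (g - n - e) + e * Multiset.card sizes →
    0 ≤ Tplus g (g - n) - 24 / 5 * (n : ℚ) + (sizes.map fun s => wsharp g n s).sum -
      pairCharge n e (g - n) sizes

/-- **`TWSumSmall`**: `TWSum` for `g ∈ {11, 12}`. -/
def TWSumSmall : Prop :=
  ∀ g n e : ℕ, 11 ≤ g → g ≤ 12 → 3 ≤ n → e ≤ 1 → n + 4 ≤ g → ∀ sizes : Multiset ℕ,
    (∀ s ∈ sizes, e + 1 ≤ s ∧ s + 3 ≤ g - n) →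
    sizes.sum = (g - n - e) + e * Multiset.card sizes →
    0 ≤ Tplus g (g - n) - 24 / 5 * (n : ℚ) + (sizes.map fun s => wsharp g n s).sum -
      pairCharge n e (g - n) sizes

/-- **`TWTable`** (mine-2's TW-100): for `13 ≤ g ≤ 100`, `n ≥ 3`, `e ∈ {0,1}`, `p = g − n ≥ 4`: every class term
`w′(g, n, s)` with `1 + e ≤ s ≤ p − 3` is nonnegative, `T⁺(g, p) ≥ 0`, and the class term of the larger class of
a covering pair (`s₁ + s₂ = p + e`, `s₂ ≤ s₁`) is at least the pair charge. -/
def TWTable : Prop :=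
  ∀ g n e : ℕ, 13 ≤ g → g ≤ 100 → 3 ≤ n → e ≤ 1 → n + 4 ≤ g →
    (∀ s, e + 1 ≤ s → s + 3 ≤ g - n → 0 ≤ wprime g n s) ∧ 0 ≤ Tplus g (g - n) ∧
    (∀ s₁ s₂, e + 1 ≤ s₁ → e + 1 ≤ s₂ → s₁ + 3 ≤ g - n → s₂ + 3 ≤ g - n → s₁ + s₂ = g - n + e →
      s₂ ≤ s₁ → 12 / 5 * (2 : ℚ) ^ (n + e) ≤ wprime g n s₁)

/-- **`TWTail`** (mine-2's TW-∞): the same for `g ≥ 101`. -/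
def TWTail : Prop :=
  ∀ g n e : ℕ, 101 ≤ g → 3 ≤ n → e ≤ 1 → n + 4 ≤ g →
    (∀ s, e + 1 ≤ s → s + 3 ≤ g - n → 0 ≤ wprime g n s) ∧ 0 ≤ Tplus g (g - n) ∧
    (∀ s₁ s₂, e + 1 ≤ s₁ → e + 1 ≤ s₂ → s₁ + 3 ≤ g - n → s₂ + 3 ≤ g - n → s₁ + s₂ = g - n + e →
      s₂ ≤ s₁ → 12 / 5 * (2 : ℚ) ^ (n + e) ≤ wprime g n s₁)

/-- `w♯ = w′ + (24/5)·n`. -/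
theorem wsharp_eq (g n s : ℕ) : wsharp g n s = wprime g n s + 24 / 5 * (n : ℚ) := by
  unfold wsharp wprime
  ring

/-- **The termwise form gives the sum form** (for a given `(g, n, e)`): with `T⁺(g,p) ≥ 0`, every `w′ ≥ 0` and
the pair charge absorbed by the larger class, the sum `T⁺(g,p) − (24/5)n + Σ w♯ − charge` is nonnegative since
`Σ w♯ = Σ w′ + (24/5)·n·#sizes` and `#sizes ≥ 1`. -/
theorem sum_nonneg_of_termwise (g n e : ℕ) (he : e ≤ 1) (hng : n + 4 ≤ g)
    (h1 : ∀ s, e + 1 ≤ s → s + 3 ≤ g - n → 0 ≤ wprime g n s) (h2 : 0 ≤ Tplus g (g - n))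
    (h3 : ∀ s₁ s₂, e + 1 ≤ s₁ → e + 1 ≤ s₂ → s₁ + 3 ≤ g - n → s₂ + 3 ≤ g - n → s₁ + s₂ = g - n + e →
      s₂ ≤ s₁ → 12 / 5 * (2 : ℚ) ^ (n + e) ≤ wprime g n s₁)
    (sizes : Multiset ℕ) (hsz : ∀ s ∈ sizes, e + 1 ≤ s ∧ s + 3 ≤ g - n)
    (hsum : sizes.sum = (g - n - e) + e * Multiset.card sizes) :
    0 ≤ Tplus g (g - n) - 24 / 5 * (n : ℚ) + (sizes.map fun s => wsharp g n s).sum -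
      pairCharge n e (g - n) sizes := by
  -- `Σ w♯ = Σ w′ + (24/5)·n·#sizes`
  have hmap : (sizes.map fun s => wsharp g n s).sum =
      (sizes.map fun s => wprime g n s).sum + 24 / 5 * (n : ℚ) * Multiset.card sizes := by
    have : (sizes.map fun s => wsharp g n s) = sizes.map fun s => wprime g n s + 24 / 5 * (n : ℚ) := by
      apply Multiset.map_congr rfl
      intro s _
      exact wsharp_eq g n s
    rw [this, Multiset.sum_map_add, Multiset.map_const', Multiset.sum_replicate, nsmul_eq_mul]
    ring
  -- `#sizes ≥ 1`: the sizes sum to `p − e + e·#sizes ≥ 1`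
  have hcard : 1 ≤ Multiset.card sizes := by
    by_contra h
    have h0 : Multiset.card sizes = 0 := by omega
    rw [Multiset.card_eq_zero] at h0
    rw [h0] at hsum
    simp at hsum
    omega
  have hcardq : (1 : ℚ) ≤ Multiset.card sizes := by exact_mod_cast hcard
  -- every `w′` is nonnegative
  have hnn : ∀ s ∈ sizes, 0 ≤ wprime g n s := fun s hs => h1 s (hsz s hs).1 (hsz s hs).2
  have hn : (0 : ℚ) ≤ n := by positivity
  rw [hmap]
  unfold pairCharge
  split_ifs with hpair
  · -- two sizes `s₁ + s₂ = p + e`: the larger one absorbs the charge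
    obtain ⟨hc2, hs⟩ := hpair
    obtain ⟨a, b, hab⟩ := Multiset.card_eq_two.1 hc2
    subst hab
    simp only [Multiset.insert_eq_cons, Multiset.map_cons, Multiset.map_singleton, Multiset.sum_cons,
      Multiset.sum_singleton, Multiset.mem_cons, Multiset.mem_singleton, forall_eq_or_imp, forall_eq] at hs hsz hnn ⊢
    simp only [Multiset.card_cons, Multiset.card_singleton]
    push_cast
    rcases Nat.le_or_le b a with hba | hab
    · have := h3 a b hsz.1.1 hsz.2.1 hsz.1.2 hsz.2.2 (by omega) hba
      nlinarith [hnn.1, hnn.2, this, h2, hn]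
    · have := h3 b a hsz.2.1 hsz.1.1 hsz.2.2 hsz.1.2 (by omega) hab
      nlinarith [hnn.1, hnn.2, this, h2, hn]
  · have hsumnn : 0 ≤ (sizes.map fun s => wprime g n s).sum :=
      Multiset.sum_nonneg fun x hx => by
        obtain ⟨s, hs, rfl⟩ := Multiset.mem_map.1 hx
        exact hnn s hs
    nlinarith [hsumnn, h2, hn, hcardq]

/-- **`TWSum` from its three pieces.** -/
theorem twSum_of_pieces (hsmall : TWSumSmall) (htable : TWTable) (htail : TWTail) : TWSum := by
  intro g n e hg hn he hng sizes hsz hsum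
  rcases Nat.lt_or_ge g 13 with h13 | h13
  · exact hsmall g n e hg (by omega) hn he hng sizes hsz hsum
  · rcases Nat.lt_or_ge g 101 with h101 | h101
    · obtain ⟨h1, h2, h3⟩ := htable g n e h13 (by omega) hn he hng
      exact sum_nonneg_of_termwise g n e he hng h1 h2 h3 sizes hsz hsum
    · obtain ⟨h1, h2, h3⟩ := htail g n e h101 hn he hng
      exact sum_nonneg_of_termwise g n e he hng h1 h2 h3 sizes hsz hsum

/-! ## The reduction -/

/-- **`PlaneLineFourBig` from `TWSum`.** -/
theorem planeLineFourBig_of_TWSum (h : TWSum) : PlaneLineFourBig := by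
  intro β _ M _ G hs hG hr hng hpl hg hbig
  obtain ⟨D, -⟩ := exists_PLData hs hG hr hng
  have hpl' : ∀ P ∈ planes M, (P ∩ G).card + 3 ≤ G.card := fun P hP => by have := hpl P hP; omega
  have h3 : 3 ≤ D.L.card := PLData.three_le_card_L' (D := D) (hpl' _ D.plane)
  have h2 : 2 ≤ D.L.card := by omega
  -- `g ≥ 11`: a plane trace of `≥ 8` points has `≤ g − 3`
  have hg11 : 11 ≤ G.card := by
    obtain ⟨P, hP, hP8⟩ := hbig
    have := hpl' P hP
    omega
  have hsplit := D.card_ρ_add_card_L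
  have he : (D.ellF ∩ D.ρ).card ≤ 1 := PLData.card_ellF_inter_ρ_le_one hs hG h2
  -- `p ≥ 4`: a class has `1 ≤ s ≤ p − 3`
  have hp4 : 4 ≤ D.ρ.card := by
    obtain ⟨C, hC⟩ := PLData.classes_nonempty (D := D) hs hG h2
    have := PLData.card_class_le hs hG h2 hpl' hC
    omega
  have hTW := PLData.J_four_ge_TW' (D := D) hs hG hr hpl' (by omega)
  -- the clause on the class sizes of `D`
  set sizes : Multiset ℕ := D.classes.val.map Finset.card with hsizes
  have hsz : ∀ s ∈ sizes, (D.ellF ∩ D.ρ).card + 1 ≤ s ∧ s + 3 ≤ G.card - D.L.card := by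
    intro s hs
    rw [hsizes, Multiset.mem_map] at hs
    obtain ⟨C, hC, rfl⟩ := hs
    have hC' : C ∈ D.classes := hC
    obtain ⟨ha, hb⟩ := PLData.card_class_le hs hG h2 hpl' hC'
    refine ⟨ha, ?_⟩
    have hρ : D.ρ.card = G.card - D.L.card := by omega
    rw [← hρ]
    exact hb
  have hsum : sizes.sum = (G.card - D.L.card - (D.ellF ∩ D.ρ).card) +
      (D.ellF ∩ D.ρ).card * Multiset.card sizes := by
    have h := PLData.sum_card_classes' (D := D) hs hG h2
    rw [Finset.sum_eq_multiset_sum] at h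
    rw [hsizes, Multiset.card_map, Finset.card_val, h]
    have : D.ρ.card = G.card - D.L.card := by omega
    rw [this]
  have hclause := h G.card D.L.card (D.ellF ∩ D.ρ).card hg11 h3 he (by omega) sizes hsz hsum
  -- the clause expression is at most the TW expression
  have hρ : D.ρ.card = G.card - D.L.card := by omega
  have hwsum : ∑ C ∈ D.classes, wsharp G.card D.L.card C.card =
      (sizes.map fun s => wsharp G.card D.L.card s).sum := by
    rw [Finset.sum_eq_multiset_sum, hsizes, Multiset.map_map]
    rfl
  have hcharge : 12 / 5 * (2 : ℚ) ^ (D.L.card + (D.ellF ∩ D.ρ).card) *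
      (if D.coverPairs.Nonempty then 1 else 0) ≤ pairCharge D.L.card (D.ellF ∩ D.ρ).card (G.card - D.L.card) sizes := by
    unfold pairCharge
    split_ifs with hne hcond hcond
    · exact le_of_eq (by ring)
    · exfalso
      obtain ⟨hcard2, A, hA, B, hB, hAB, hcl, hsumAB⟩ := PLData.coverPairs_card_classes hs hG h2 hne
      apply hcond
      refine ⟨?_, ?_⟩
      · rw [hsizes, Multiset.card_map, Finset.card_val, hcard2]
      · rw [hsizes, ← Finset.sum_eq_multiset_sum, hcl, Finset.sum_pair hAB, hsumAB, hρ]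
    · simp only [mul_zero]
      positivity
    · simp
  rw [hρ] at hTW
  rw [hwsum] at hTW
  linarith

end PercRepro.SixFour
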